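import Summits.FinalStateConjecture.FinalStateConjecture.Theses.PhaseMixingCapture
import Summits.FinalStateConjecture.FinalStateConjecture.Theses.SwallowTheDatum
import Summits.FinalStateConjecture.FinalStateConjecture.Theorems.PhaseMixingCaptureWeakCosmicCensorshipMGHDStubScriTransfer
import Summits.FinalStateConjecture.FinalStateConjecture.Theorems.PhaseMixingCaptureWeakCosmicCensorshipMGHDStubShieldCocompact
import Summits.FinalStateConjecture.FinalStateConjecture.Theorems.PhaseMixingCaptureWeakCosmicCensorshipMGHDStubKerrVacuum
import Summits.FinalStateConjecture.FinalStateConjecture.Theorems.PhaseMixingCaptureWeakCosmicCensorshipMGHDStubCollarRealisation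
import Summits.FinalStateConjecture.FinalStateConjecture.Theorems.PhaseMixingCaptureWeakCosmicCensorshipMGHDStubFarSojournTransfer
import Summits.FinalStateConjecture.FinalStateConjecture.Theorems.SwallowTheDatumKerrShieldedSettlesStubCollarCauchy
import Summits.FinalStateConjecture.FinalStateConjecture.Theorems.SwallowTheDatumKerrShieldedSettlesStubKerrLeafSojourn
import Summits.FinalStateConjecture.FinalStateConjecture.Theorems.KerrShieldedDataExist.Negative.BentHeight
import Literature.Geometry.Lorentzian.KerrDataProofs
import Literature.Geometry.Lorentzian.KerrSchildCoord
import HarnessLib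

/-!
# Route PhaseMixingCapture · crux `WeakCosmicCensorshipMGHD` (stmt-FinalStateConjecture-9952) —
# the line `scri-transfer-third-of-burial`, assembled: the crux from the three SwallowTheDatum items

This is the sorry-free composition of the line `scri-transfer-third-of-burial` (lead reshape v2,
`Cruxes/WeakCosmicCensorshipMGHD/Lines/scri-transfer-third-of-burial.lean`): all seven registered stubs of
the crux are landed theorems of the tree —

* `stub_scriTransfer` (the lever, generic relative transfer of far-origin sojourn completeness along an
  embedding over a sub-datum; `…PhaseMixingCaptureWeakCosmicCensorshipMGHDStubScriTransfer.lean`),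
* `stub_kerrVacuum` (`Kerr.isRicciFlat`, now the tree theorem `Kerr.isRicciFlat_holds`;
  `…StubKerrVacuum.lean`),
* `stub_collarCauchy` (the bent leaf is a Cauchy hypersurface of the tapered collar — proved for the sibling
  crux `KerrShieldedSettles` as `Theorems.SwallowTheDatum.KerrShieldedSettles.stub_collarCauchy`, whose
  statement this line registered VERBATIM; cited here by that name),
* `stub_collarRealisation` (the tapered collar with the restricted Kerr metric is a vacuum Cauchy
  development of the exterior sub-datum, realised in the chart; `…StubCollarRealisation.lean`),
* `stub_kerrLeafSojourn` (sojourn optics of the Kerr chart seen from the bent leaf — proved for the sibling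
  crux as `Theorems.SwallowTheDatum.KerrShieldedSettles.stub_kerrLeafSojourn`, statement shared VERBATIM;
  cited by that name),
* `stub_farSojournTransfer` (far-origin sojourn completeness of the realised development;
  `…StubFarSojournTransfer.lean`),
* `stub_shieldCocompact` (far shield regions of an admissible shielded datum are co-compact in `X`;
  `…StubShieldCocompact.lean`) —

so that the crux `WeakCosmicCensorshipMGHD` (Christodoulou-generically in `admissibleVacuumData X`: an MGHD
exists and EVERY MGHD has complete future null infinity in the sojourn form) follows from the three items of
route SwallowTheDatum it was planned over: `MGHDExists` (stmt-9937, Choquet-Bruhat–Geroch),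
`SubdataDevelopmentsEmbed` (stmt-10053, exterior ignorance) and `ParametricKerrBurial` (stmt-10052, the
burial).  The theorem below is therefore CONDITIONAL on those three OPEN items (hypotheses BY NAME, all
registered obligations of this sub-problem); it is the crux "closed modulo {9937, 10053, 10052}", not a
closing of the item.  Proof = the skeleton's `WeakCosmicCensorshipMGHD_of` with the stubs discharged:
unfold `IsChristodoulouGeneric … 1`; through an exceptional admissible `d` pass the burial family `F`; a
member `F c`, `c ≠ 0`, is admissible, hence has an MGHD, and is Kerr-shielded with witnesses
`(M, a, r₁, hM, T = bentHeight M a, φ, ψ, ν)`; collar Cauchy + realisation (fed by Kerr vacuum) give the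
vacuum development `𝒦` of the exterior sub-datum inside exact Kerr; leaf optics + far-sojourn transfer give
its far-origin completeness in radius form; co-compactness supplies the compact containers in `X`;
exterior ignorance embeds `𝒦` into the given maximal `𝒟` over `φ`; the lever transfers.

References: Christodoulou, CQG 16 (1999) A23, pp. A24–A27; Dafermos–Rodnianski arXiv:0811.0354 §2.6.2,
§5.1; Choquet-Bruhat–Geroch, CMP 14 (1969) Thm. 3; O'Neill 1983, Ch. 14.
-/

-- the doubled `FinalStateConjecture` path component is the summit/problem naming scheme
set_option linter.dupNamespace false

noncomputable section

open Set Function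
open scoped Manifold ContDiff Topology
open Literature.Geometry.Lorentzian
open Summit.FinalStateConjecture.FinalStateConjecture.Theses.PhaseMixingCapture (WeakCosmicCensorshipMGHD)
open Summit.FinalStateConjecture.FinalStateConjecture.Theses.SwallowTheDatum
  (ParametricKerrBurial SubdataDevelopmentsEmbed MGHDExists)
open Summit.FinalStateConjecture.FinalStateConjecture.Theorems.KerrShieldedDataExist.Negative
  (bentHeight bentHeight_eq_literal)

namespace Summit.FinalStateConjecture.FinalStateConjecture.Theorems.PhaseMixingCapture.WeakCosmicCensorshipMGHD

/-- **The crux `WeakCosmicCensorshipMGHD` from the three SwallowTheDatum items** (line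
`scri-transfer-third-of-burial` assembled; all seven registered stubs discharged by landed theorems).
`MGHDExists → SubdataDevelopmentsEmbed → ParametricKerrBurial → WeakCosmicCensorshipMGHD`: for every
connected Hausdorff second-countable `3`-manifold `X`, Christodoulou-generically in `admissibleVacuumData X`
an MGHD exists and every MGHD has complete `𝓘⁺` (sojourn form), GRANTED Choquet-Bruhat–Geroch existence for
admissible data (stmt-9937), exterior ignorance (stmt-10053) and the parametric Kerr burial (stmt-10052).
CONDITIONAL on those three open items; nothing else is assumed (`Kerr.Facts` and the connectedness of the
Kerr–Schild slices are tree theorems). -/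
theorem WeakCosmicCensorshipMGHD_of :
    MGHDExists → SubdataDevelopmentsEmbed → ParametricKerrBurial → WeakCosmicCensorshipMGHD := by
  intro hM hE hB X _ _ _ _ _ _ d hd
  haveI : Kerr.Facts :=
    ⟨Kerr.isConnected_region_holds, Kerr.contMDiff_bilin_holds, Kerr.contMDiff_timeVector_holds⟩
  obtain ⟨F, h1, h2, h3, h4, h5⟩ := hB X d hd.1
  refine ⟨F, h1, h2, h3, h4, fun c hc hmem ↦ hmem.2 ⟨hM X (F c) (h4 c), fun 𝒟 hmax ↦ ?_⟩⟩
  obtain ⟨M, a, r₁, hM₀, T, φ, ψ, ν, ha, hr₁, hr₂, hTdef, hcpt, hopen, hφs, hψ, hsp, hν, hh, hk⟩ :=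
    h5 c hc
  subst hTdef
  haveI : ConnectedSpace (Kerr.slice a r₁) :=
    isConnected_iff_connectedSpace.mp (Kerr.isConnected_slice_holds a r₁)
  have hψ' : ∀ y : Kerr.slice a r₁, (ψ y : E4) =
      E4.ofTimeSpace (bentHeight M a (Kerr.radius a (E4.ofTimeSpace 0 (y : E3)))) (y : E3) :=
    fun y ↦ by rw [bentHeight_eq_literal]; exact hψ y
  have hsub : Kerr.IsSubextremal M a := ha
  -- the tapered collar realised as a vacuum development of the exterior sub-datum (stubs C, R, V)
  obtain ⟨hΦ, hΦ', 𝒦, j, hreal⟩ :=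
    stub_collarRealisation X (F c) M a r₁ hM₀ φ ψ ν
      ⟨ha, hr₁, hr₂, hcpt, hopen, hφs, hψ', hsp, hν, hh, hk⟩
      (Summit.FinalStateConjecture.FinalStateConjecture.Theorems.SwallowTheDatum.KerrShieldedSettles.stub_collarCauchy
        M a r₁ hM₀ ha hr₁ hr₂)
      (stub_kerrVacuum M a r₁ hsub)
  -- exterior ignorance: `𝒦` embeds into the maximal development over `φ`
  obtain ⟨χ, hχ, hχo, hiso, hτ, hcomm⟩ := hE X (F c) 𝒟 hmax (Kerr.slice a r₁) φ hΦ hΦ' hopen 𝒦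
  -- `HasCompleteNullInfinity` binds the (provable) Levi-Civita instance of `𝒟`; introduce it.
  intro hLC
  refine stub_scriTransfer X (F c) 𝒟.toCauchyDevelopment (Kerr.slice a r₁) φ hΦ hΦ' hopen
    𝒦.toDataEmbedding χ hχ hχo hiso hτ hcomm (Set.range φ)ᶜ hcpt (by rw [compl_compl]) ?_
  intro _instK
  -- far-origin completeness of `𝒦` (stub F fed by stub O), read at the bound instance
  obtain ⟨R₀, hR₀⟩ :=
    stub_farSojournTransfer X (F c) M a r₁ hM₀ φ ψ ν
      ⟨ha, hr₁, hr₂, hcpt, hopen, hφs, hψ', hsp, hν, hh, hk⟩ hΦ hΦ' 𝒦 j hreal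
      (Summit.FinalStateConjecture.FinalStateConjecture.Theorems.SwallowTheDatum.KerrShieldedSettles.stub_kerrLeafSojourn
        M a r₁ hM₀ ha hr₁ hr₂ ψ ν hψ' hν)
  -- compact containers in `X` (stub K)
  obtain ⟨K₀, hK₀c, hK₀⟩ := stub_shieldCocompact X (F c) (h4 c) M a r₁ hM₀ φ ψ ν
    ⟨ha, hr₁, hr₂, hcpt, hopen, hφs, hψ', hsp, hν, hh, hk⟩ (R₀ + 1)
  refine ⟨K₀, hK₀c, fun s hs ↦ ?_⟩
  obtain ⟨R₁, hR₁⟩ := hR₀ s hs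
  obtain ⟨K₁, hK₁c, hK₁⟩ := stub_shieldCocompact X (F c) (h4 c) M a r₁ hM₀ φ ψ ν
    ⟨ha, hr₁, hr₂, hcpt, hopen, hφs, hψ', hsp, hν, hh, hk⟩ R₁
  refine ⟨K₁, hK₁c, fun p hp γ dom hγ ↦ ?_⟩
  have hpR : R₁ ≤ Kerr.radius a (E4.ofTimeSpace 0 (p : E3)) := by
    obtain ⟨y', hy', hyp⟩ := hK₁ hp
    rw [← hopen.injective hyp]
    exact hy'
  rcases hR₁ p hpR γ dom hγ with h | h
  · exact Or.inl h
  · refine Or.inr (h.trans (sojournTime_mono _ _ (LorentzianMetric.causalFuture_mono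
      (image_mono fun y' hy' ↦ ?_))))
    -- `{r ≤ R₀} ⊆ φ⁻¹ K₀`: a far shield point outside `K₀` has radius `≥ R₀ + 1`
    by_contra hn
    obtain ⟨y'', hy'', he⟩ := hK₀ hn
    have := hopen.injective he
    subst this
    simp only [Set.mem_setOf_eq] at hy' hy''
    linarith

end Summit.FinalStateConjecture.FinalStateConjecture.Theorems.PhaseMixingCapture.WeakCosmicCensorshipMGHD

end
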